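import Literature.AlgebraicTopology.Homotopy.IteratedSuspension
import Mathlib.Topology.TietzeExtension
import Mathlib.Topology.Compactification.OnePoint.Basic
import Mathlib.Topology.Piecewise
import HarnessLib

/-!
# The collapse map of a tube onto an iterated suspension

The point-set construction behind the Pontryagin–Thom collapse in the form used for Wu-class
arguments (Milnor–Stasheff, *Characteristic classes* (1974), §18 pp. 215–216, the collapse
`Sⁿ⁺ᵏ → T(ν)`; here in an elementary "suspension" form, without Thom spaces): let `W` be a
compact Hausdorff space, `X ⊆ W` open (the interior of a manifold with boundary), `S` a compact
Hausdorff space (a sphere), and `t : W × [0,1]ᴺ → S` a continuous injection — a closed TUBE —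
whose restriction to `X × (0,1)ᴺ` has open image `To` (the open tube). Let `X⁺` be the one-point
compactification of `X` (the closed model `Ŵ = W/∂W` when `X = W ∖ ∂W`) and `q : W → X⁺` the
collapse (`tubeCollapse.collapse`, continuous). Then there is a continuous map

  `g : S → Sᴺ X⁺` (`tubeCollapse.map`)

into the `N`-fold unreduced suspension (`IteratedSuspension.lean`) with
`g (t (w, θ)) = κ N (q w, θ)` on the closed tube (`map_tube`) and `g s = κ N (∞, θₛ)` off the
open tube (`exists_map_eq_of_not_mem`): on the closed tube `g` is `κ N ∘ (q × id) ∘ t⁻¹`, off it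
`s ↦ κ N (∞, τ s)` for a Tietze extension `τ : S → [0,1]ᴺ` of the cube coordinate of the tube
boundary — the two agree there because `q = ∞` off `X` and `κ N` forgets the point at the faces
of the cube (`κ_eq_of_exists`). Consequently `g⁻¹` of the open part
`U = {ι N (x, θ) | x ∈ X, θ ∈ (0,1)ᴺ}` of `Sᴺ X⁺` is exactly the open tube (`mem_openTube_iff`),
on which `g` is `t (x, θ) ↦ ι N (x, θ)` (`map_tube_coe`).

Everything is proved; no named facts.

## References

* J. Milnor, J. Stasheff, *Characteristic classes*, Princeton UP 1974, §18 pp. 215–216.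
  [MilnorStasheff1974]
* A. Hatcher, *Algebraic Topology*, CUP 2002, Ch. 0 p. 8. [Hatcher2002]
-/

noncomputable section

open unitInterval Set Function OnePoint
open _root_.Topology

universe u

namespace Literature.AlgebraicTopology.Homotopy

/-- `[0, 1]` is a Tietze extension space (a retract of `ℝ` by `projIcc`). [folklore] -/
instance instTietzeExtensionUnitInterval : TietzeExtension.{u, 0} I :=
  TietzeExtension.of_retract (⟨Subtype.val, continuous_subtype_val⟩ : C(I, ℝ))
    ⟨Set.projIcc 0 1 zero_le_one, continuous_projIcc⟩ (by
      ext x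
      exact congrArg Subtype.val (Set.projIcc_val zero_le_one x))

namespace tubeCollapse

section Collapse

variable {W : Type u} {X : Set W}

/-! ### The collapse `W → X⁺` -/

open Classical in
/-- **The collapse map** `q : W → X⁺`: the identity on the open subset `X`, everything else to
the point at infinity (for `X` the interior of a compact manifold with boundary this is
`W → W/∂W`). [folklore] -/
def collapse (X : Set W) (w : W) : OnePoint X :=
  if h : w ∈ X then ((⟨w, h⟩ : X) : OnePoint X) else ∞

/-- On `X` the collapse is the inclusion. [folklore] -/
lemma collapse_of_mem {w : W} (h : w ∈ X) : collapse X w = ((⟨w, h⟩ : X) : OnePoint X) := by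
  rw [collapse, dif_pos h]

/-- Off `X` the collapse is `∞`. [folklore] -/
lemma collapse_of_not_mem {w : W} (h : w ∉ X) : collapse X w = ∞ := by
  rw [collapse, dif_neg h]

/-- `collapse X x = x` for `x : X`. [folklore] -/
@[simp] lemma collapse_coe (x : X) : collapse X (x : W) = (x : OnePoint X) := by
  rw [collapse_of_mem x.2]

/-- `collapse X w = ∞` iff `w ∉ X`. [folklore] -/
lemma collapse_eq_infty_iff {w : W} : collapse X w = ∞ ↔ w ∉ X := by
  constructor
  · intro h hw
    rw [collapse_of_mem hw] at h
    exact OnePoint.coe_ne_infty _ h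
  · exact collapse_of_not_mem

/-- **The collapse is continuous** (for `W` compact Hausdorff and `X` open): the preimage of a
neighbourhood `{∞} ∪ (X ∖ K)` of `∞` (`K ⊆ X` compact) is `W ∖ K`. [folklore] -/
theorem continuous_collapse [TopologicalSpace W] [CompactSpace W] [T2Space W] (hX : IsOpen X) :
    Continuous (collapse X) := by
  rw [continuous_def]
  intro U hU
  by_cases hinf : ∞ ∈ U
  · obtain ⟨-, hK⟩ := (isOpen_iff_of_mem hinf).1 hU
    have hpre : collapse X ⁻¹' U = (Subtype.val '' ((↑) ⁻¹' U : Set X)ᶜ)ᶜ := by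
      ext w
      simp only [mem_preimage, mem_compl_iff, mem_image, not_exists, not_and]
      constructor
      · rintro hw x hx rfl
        rw [collapse_coe] at hw
        exact hx hw
      · intro hw
        by_cases h : w ∈ X
        · rw [collapse_of_mem h]
          by_contra hc
          exact hw ⟨w, h⟩ hc rfl
        · rw [collapse_of_not_mem h]; exact hinf
    rw [hpre, isOpen_compl_iff]
    exact (hK.image continuous_subtype_val).isClosed
  · have hpre : collapse X ⁻¹' U = Subtype.val '' ((↑) ⁻¹' U : Set X) := by
      ext w
      simp only [mem_preimage, mem_image]
      constructor
      · intro hw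
        by_cases h : w ∈ X
        · rw [collapse_of_mem h] at hw; exact ⟨⟨w, h⟩, hw, rfl⟩
        · rw [collapse_of_not_mem h] at hw; exact absurd hw hinf
      · rintro ⟨x, hx, rfl⟩
        rwa [collapse_coe]
    rw [hpre]
    exact hX.isOpenMap_subtype_val _ ((isOpen_iff_of_notMem hinf).1 hU)

end Collapse

/-! ### The cube -/

section Cube

variable {N : ℕ}

/-- The open cube `(0,1)ᴺ ⊆ [0,1]ᴺ`. [folklore] -/
def openCube (N : ℕ) : Set (Fin N → I) := Set.pi univ fun _ => Susp.midHeights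

/-- The open cube is open. [folklore] -/
lemma isOpen_openCube : IsOpen (openCube N) :=
  isOpen_set_pi finite_univ fun _ _ => Susp.isOpen_midHeights

/-- A point of `[0,1]ᴺ` outside the open cube has a coordinate equal to `0` or `1`. [folklore] -/
lemma exists_eq_zero_or_one_of_not_mem {θ : Fin N → I} (h : θ ∉ openCube N) :
    ∃ i, θ i = 0 ∨ θ i = 1 := by
  simp only [openCube, mem_univ_pi, not_forall] at h
  obtain ⟨i, hi⟩ := h
  refine ⟨i, ?_⟩
  by_contra hc
  push Not at hc
  apply hi
  refine ⟨lt_of_le_of_ne (θ i).2.1 (fun e => hc.1 (Subtype.ext e.symm)),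
    lt_of_le_of_ne (θ i).2.2 (fun e => hc.2 (Subtype.ext e))⟩

end Cube

/-! ### The tube data -/

section Tube

variable {W : Type u} [TopologicalSpace W] [CompactSpace W] {X : Set W}
variable {S : Type u} [TopologicalSpace S] [T2Space S]
variable {N : ℕ} {t : W × (Fin N → I) → S}

variable (X t) in
/-- **The open tube** `To = t (X × (0,1)ᴺ)`. [folklore] -/
def openTube : Set S := t '' (X ×ˢ openCube N)

/-- The inverse of the closed tube on its (closed) range, a homeomorphism
`range t ≃ₜ W × [0,1]ᴺ` (a continuous injection from a compact space to a Hausdorff space is a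
closed embedding). [folklore] -/
def tubeInv (ht : Continuous t) (hinj : Injective t) : range t ≃ₜ W × (Fin N → I) :=
  (ht.isClosedEmbedding hinj).isEmbedding.toHomeomorph.symm

/-- `t⁻¹ (t x) = x`. [folklore] -/
lemma tubeInv_apply_tube (ht : Continuous t) (hinj : Injective t) (x : W × (Fin N → I)) :
    tubeInv ht hinj ⟨t x, mem_range_self x⟩ = x :=
  (ht.isClosedEmbedding hinj).isEmbedding.toHomeomorph_symm_apply x

/-- `t (t⁻¹ s) = s`. [folklore] -/
lemma tube_tubeInv (ht : Continuous t) (hinj : Injective t) (s : range t) :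
    t (tubeInv ht hinj s) = s := by
  obtain ⟨_, x, rfl⟩ := s
  rw [tubeInv_apply_tube]

/-- The closed set on which the cube coordinate is prescribed: the closed tube minus the open
tube. [folklore] -/
lemma isClosed_range_diff_openTube (ht : Continuous t) (hinj : Injective t)
    (hTo : IsOpen (openTube X t)) : IsClosed (range t ∩ (openTube X t)ᶜ) :=
  (ht.isClosedEmbedding hinj).isClosed_range.inter hTo.isClosed_compl

/-- **A Tietze extension of the cube coordinate**: a continuous `τ : S → [0,1]ᴺ` with
`τ (t (w, θ)) = θ` whenever `t (w, θ)` is not in the open tube (`S` compact Hausdorff, hence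
normal). [folklore] -/
theorem exists_cubeCoord [CompactSpace S] (ht : Continuous t) (hinj : Injective t)
    (hTo : IsOpen (openTube X t)) :
    ∃ τ : C(S, Fin N → I), ∀ x : W × (Fin N → I), t x ∉ openTube X t → τ (t x) = x.2 := by
  set C : Set S := range t ∩ (openTube X t)ᶜ with hC
  have hCc : IsClosed C := isClosed_range_diff_openTube ht hinj hTo
  let f₀ : C(C, Fin N → I) :=
    { toFun := fun s => (tubeInv ht hinj ⟨s.1, s.2.1⟩).2
      continuous_toFun := continuous_snd.comp ((tubeInv ht hinj).continuous.comp
        (continuous_inclusion inter_subset_left)) }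
  obtain ⟨τ, hτ⟩ := f₀.exists_restrict_eq hCc
  refine ⟨τ, fun x hx => ?_⟩
  have hmem : t x ∈ C := ⟨mem_range_self x, hx⟩
  have := congrFun (congrArg DFunLike.coe hτ) ⟨t x, hmem⟩
  change τ (t x) = (tubeInv ht hinj ⟨t x, _⟩).2 at this
  rw [this, tubeInv_apply_tube]

end Tube

/-! ### The open part of the iterated suspension over `X` -/

section OpenPart

variable {W : Type u} [TopologicalSpace W] {X : Set W} {N : ℕ}

/-- Points `κ N (∞, θ)` are never of the form `ι N (x, θ')` with `x ∈ X`. [folklore] -/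
lemma κ_infty_ne_ι (θ : Fin N → I) (x : X) (θ' : Fin N → Susp.midHeights) :
    suspN.κ N ((∞ : OnePoint X), θ) ≠ suspN.ι N ((x : OnePoint X), θ') := by
  intro h
  rw [← suspN.κ_eq_ι] at h
  by_cases hθ : ∀ i, θ i ∈ Susp.midHeights
  · have := (suspN.κ_injOn N hθ (fun i => (θ' i).2) h).1
    exact OnePoint.infty_ne_coe x this
  · push Not at hθ
    exact suspN.κ_ne_κ_of_mem_of_not_mem N _ _ _ _ (fun i => (θ' i).2) hθ h.symm

variable (X N) in
/-- **The open part** `U = {ι N (x, θ) | x ∈ X, θ ∈ (0,1)ᴺ}` of `Sᴺ X⁺` over `X`. [folklore] -/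
def openPart : Set (suspN (OnePoint X) N) :=
  range fun p : X × (Fin N → Susp.midHeights) => suspN.ι N ((p.1 : OnePoint X), p.2)

/-- The parametrisation of the open part is an open embedding. [folklore] -/
theorem isOpenEmbedding_openPart :
    IsOpenEmbedding fun p : X × (Fin N → Susp.midHeights) => suspN.ι N ((p.1 : OnePoint X), p.2) :=
  (suspN.isOpenEmbedding_ι N).comp (OnePoint.isOpenEmbedding_coe.prodMap IsOpenEmbedding.id)

/-- The open part is open. [folklore] -/
theorem isOpen_openPart : IsOpen (openPart X N) := isOpenEmbedding_openPart.isOpen_range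

end OpenPart

/-! ### The collapse map `S → Sᴺ X⁺` -/

section Map

variable {W : Type u} [TopologicalSpace W] [CompactSpace W] [T2Space W] (X : Set W)
variable {S : Type u} [TopologicalSpace S] [T2Space S]
variable {N : ℕ} {t : W × (Fin N → I) → S}

open Classical in
/-- The map on the closed tube, extended arbitrarily: `κ N (q w, θ)` at `t (w, θ)`. [folklore] -/
def mapOnTube (ht : Continuous t) (hinj : Injective t) (s : S) : suspN (OnePoint X) N :=
  if h : s ∈ range t then
    suspN.κ N (collapse X (tubeInv ht hinj ⟨s, h⟩).1, (tubeInv ht hinj ⟨s, h⟩).2)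
  else suspN.κ N (∞, fun _ => 0)

variable {X} in
omit [T2Space W] in
/-- `mapOnTube` on the closed tube. [folklore] -/
lemma mapOnTube_tube (ht : Continuous t) (hinj : Injective t) (x : W × (Fin N → I)) :
    mapOnTube X ht hinj (t x) = suspN.κ N (collapse X x.1, x.2) := by
  rw [mapOnTube, dif_pos (mem_range_self x), tubeInv_apply_tube]

variable {X} in
/-- `mapOnTube` is continuous on the closed tube. [folklore] -/
lemma continuousOn_mapOnTube (hX : IsOpen X) (ht : Continuous t) (hinj : Injective t) :
    ContinuousOn (mapOnTube X ht hinj) (range t) := by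
  rw [continuousOn_iff_continuous_restrict]
  have h : (range t).restrict (mapOnTube X ht hinj) = fun s : range t =>
      suspN.κ N (collapse X (tubeInv ht hinj s).1, (tubeInv ht hinj s).2) := by
    funext s
    change mapOnTube X ht hinj s.1 = _
    rw [mapOnTube, dif_pos s.2]
  rw [h]
  exact (suspN.continuous_κ N).comp (((continuous_collapse hX).comp
    (continuous_fst.comp (tubeInv ht hinj).continuous)).prodMk
      (continuous_snd.comp (tubeInv ht hinj).continuous))

open Classical in
/-- **The collapse map** `g : S → Sᴺ X⁺` for a cube coordinate `τ`: `κ N (q w, θ)` on the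
closed tube, `κ N (∞, τ s)` elsewhere (Milnor–Stasheff 1974, §18, the Pontryagin–Thom collapse,
in suspension form). [cite: MilnorStasheff1974, §18 pp. 215–216] -/
def map (ht : Continuous t) (hinj : Injective t) (τ : C(S, Fin N → I)) (s : S) :
    suspN (OnePoint X) N :=
  if s ∈ range t then mapOnTube X ht hinj s else suspN.κ N (∞, τ s)

variable {X}

omit [CompactSpace W] [T2Space W] [TopologicalSpace S] [T2Space S] in
/-- The key compatibility: outside the open tube, `κ N (q w, θ) = κ N (∞, θ)` at `t (w, θ)`
(either `w ∉ X`, so `q w = ∞`, or `θ` lies on a face of the cube, where `κ N` forgets the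
point). [folklore] -/
lemma κ_collapse_eq_of_not_mem {x : W × (Fin N → I)} (hx : t x ∉ openTube X t) :
    suspN.κ N (collapse X x.1, x.2) = suspN.κ N (∞, x.2) := by
  by_cases hw : x.1 ∈ X
  · have hθ : x.2 ∉ openCube N := fun hθ => hx ⟨x, ⟨hw, hθ⟩, rfl⟩
    exact suspN.κ_eq_of_exists N _ _ _ (exists_eq_zero_or_one_of_not_mem hθ)
  · rw [collapse_of_not_mem hw]

/-- **The collapse map is continuous** when `τ` is a cube coordinate (pasting along the closed
cover `{range t, S ∖ To}`). [cite: MilnorStasheff1974, §18 pp. 215–216] -/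
theorem continuous_map (hX : IsOpen X) (ht : Continuous t) (hinj : Injective t)
    (hTo : IsOpen (openTube X t)) {τ : C(S, Fin N → I)}
    (hτ : ∀ x : W × (Fin N → I), t x ∉ openTube X t → τ (t x) = x.2) :
    Continuous (map X ht hinj τ) := by
  classical
  have hcl : IsClosed (range t) := (ht.isClosedEmbedding hinj).isClosed_range
  change Continuous fun s => if s ∈ range t then mapOnTube X ht hinj s else suspN.κ N (∞, τ s)
  refine continuous_if (fun a ha => ?_) ?_ ?_
  · -- agreement on the frontier of the closed tube
    have ha1 : a ∈ range t := by
      have := frontier_subset_closure (s := {x : S | x ∈ range t}) ha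
      rwa [show {x : S | x ∈ range t} = range t from rfl, hcl.closure_eq] at this
    have ha2 : a ∉ openTube X t := by
      intro hmem
      have hint : a ∈ interior {x : S | x ∈ range t} := by
        rw [show {x : S | x ∈ range t} = range t from rfl]
        exact interior_maximal (image_subset_range _ _) hTo hmem
      exact ha.2 hint
    obtain ⟨x, rfl⟩ := ha1
    rw [mapOnTube_tube, hτ x ha2, κ_collapse_eq_of_not_mem ha2]
  · rw [show {x : S | x ∈ range t} = range t from rfl, hcl.closure_eq]
    exact continuousOn_mapOnTube hX ht hinj
  · exact ((suspN.continuous_κ N).comp (continuous_const.prodMk τ.continuous)).continuousOn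

omit [T2Space W] in
/-- **On the closed tube** `g (t (w, θ)) = κ N (q w, θ)`. [cite: MilnorStasheff1974, §18 pp. 215–216] -/
theorem map_tube (ht : Continuous t) (hinj : Injective t) (τ : C(S, Fin N → I))
    (x : W × (Fin N → I)) : map X ht hinj τ (t x) = suspN.κ N (collapse X x.1, x.2) := by
  rw [map, if_pos (mem_range_self x), mapOnTube_tube]

omit [T2Space W] in
/-- On the open tube `g (t (x, θ)) = ι N (x, θ)`. [folklore] -/
theorem map_tube_coe (ht : Continuous t) (hinj : Injective t) (τ : C(S, Fin N → I))
    (x : X) (θ : Fin N → Susp.midHeights) :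
    map X ht hinj τ (t ((x : W), fun i => (θ i).1)) = suspN.ι N ((x : OnePoint X), θ) := by
  rw [map_tube, collapse_coe]; rfl

omit [T2Space W] in
/-- **Off the open tube** `g s = κ N (∞, θ)` for some `θ`. [cite: MilnorStasheff1974, §18 pp. 215–216] -/
theorem exists_map_eq_of_not_mem (ht : Continuous t) (hinj : Injective t) (τ : C(S, Fin N → I))
    {s : S} (hs : s ∉ openTube X t) : ∃ θ : Fin N → I, map X ht hinj τ s = suspN.κ N (∞, θ) := by
  by_cases h : s ∈ range t
  · obtain ⟨x, rfl⟩ := h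
    exact ⟨x.2, by rw [map_tube, κ_collapse_eq_of_not_mem hs]⟩
  · exact ⟨τ s, by rw [map, if_neg h]⟩

omit [T2Space W] in
/-- **The collapse map pulls the open part back to the open tube**: `g s ∈ U ↔ s ∈ To`.
[cite: MilnorStasheff1974, §18 pp. 215–216] -/
theorem mem_openTube_iff (ht : Continuous t) (hinj : Injective t) (τ : C(S, Fin N → I)) (s : S) :
    map X ht hinj τ s ∈ openPart X N ↔ s ∈ openTube X t := by
  constructor
  · intro hs
    by_contra hns
    obtain ⟨θ, hθ⟩ := exists_map_eq_of_not_mem ht hinj τ hns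
    obtain ⟨⟨x, θ'⟩, hx⟩ := hs
    exact κ_infty_ne_ι θ x θ' (hθ ▸ hx.symm)
  · rintro ⟨⟨w, θ⟩, ⟨hw, hθ⟩, rfl⟩
    refine ⟨(⟨w, hw⟩, fun i => ⟨θ i, hθ i (mem_univ i)⟩), ?_⟩
    change suspN.ι N _ = map X ht hinj τ (t (w, θ))
    rw [map_tube, collapse_of_mem hw]
    rfl

end Map

end tubeCollapse

end Literature.AlgebraicTopology.Homotopy
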